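import Summits.HodgeConjecture.CorCM.HypD3.A4LiuD3Items
import Summits.HodgeConjecture.CorCM.HypD3.A4LiuD3SameClassChiNonsplit
import Summits.HodgeConjecture.CorCM.HypD3.A4LiuD3SameClassOfSplit
import HarnessLib

/-!
# `hD3` line `a4-liuD3`: the stub TYPES :185 and :199 of `A4LiuD3Items` are INHABITED in the tree, by name

Summits side, binder subdirectory `CorCM/HypD3/` (cell `hodgecm-mathlib`; crux item stmt-HodgeConjecture-24837).  Two one-line theorems
certifying IN THE KERNEL that the registered v2 stub types of `Summits/HodgeConjecture/CorCM/HypD3/A4LiuD3Items.lean`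
(`Summit.HodgeConjecture.CorCM.Lines.A4LiuD3.SameClassChiOfIsoNonsplit`, `….SameClassOfSplit`) are closed BY NAME by the landed closers
`CorCM/HypD3/A4LiuD3SameClassChiNonsplit.lean` (A-p05, modulo row IV-4c1 which is the Prop's own leading binder) and
`CorCM/HypD3/A4LiuD3SameClassOfSplit.lean` (B-p18, general `e`, instantiated at `e₁`) — so the skeleton v2's slots `stub_sameClass_and_chi_of_iso_nonsplit`
and `stub_sameClass_of_split` are the terms `sameClassChiOfIsoNonsplit_holds` / `sameClassOfSplit_holds` below.  No new mathematics.

HC_CM is proved only modulo the 7 printed citations (`hDel`, `h21`, `hLiu418`, `h411`, `h413`, `hD3`, `hD1''`) until rung 0 closes; `hD3` itself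
still has the stubs :190, :195 (modulo facts + F2), :203 open and the residual facts IV-4c1/c3/c4.

## References
* [Liu2021] Y. Liu, Camb. J. Math. 9 (2021) = arXiv:2102.11518, App. D Lemma D.1 (3) (l. 5233).
-/

set_option autoImplicit false

noncomputable section

namespace Summit.HodgeConjecture.CorCM.Lines.A4LiuD3

open HodgeCM.Model.ArchSideTerm (e₁)

/-- **stub (:185) of `a4-liuD3` v2 is closed by name**: the registered type `SameClassChiOfIsoNonsplit` (row IV-4c1 as leading binder,
`e := e₁`) is inhabited by A-p05's `HypD3.sameClassChiOfIsoNonsplit`. [cite: Liu2021, App. D Lemma D.1 (3) (l. 5233)] -/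
theorem sameClassChiOfIsoNonsplit_holds : SameClassChiOfIsoNonsplit :=
  Summit.HodgeConjecture.CorCM.HypD3.sameClassChiOfIsoNonsplit

/-- **stub (:199) of `a4-liuD3` v2 is closed by name**: the registered type `SameClassOfSplit` (`e := e₁`) is inhabited by B-p18's
general-`e` theorem `HypD3.sameClassOfSplit` at `e₁`. [cite: Liu2021, App. D Lemma D.1 (3) (l. 5233), proof l. 5249–5254] -/
theorem sameClassOfSplit_holds : SameClassOfSplit :=
  fun F => Summit.HodgeConjecture.CorCM.HypD3.sameClassOfSplit F e₁

end Summit.HodgeConjecture.CorCM.Lines.A4LiuD3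

end
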